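import Summits.HodgeConjecture.CorCM.Census.OddSliceFacesModel

/-!
# The quartic twist `(ℤ/4 × B, (2,0))`, `B` any finite group, I: clock types `B → ℤ/4`, Pohlmann forms, the Hodge lattice, pairs,
# Galois translation, places and flips

COR-CM (cell `pub-hodgecm2`), count-neutral kernel combinatorics by the binder seat b09 (gen 32; lane QUARTIC-TWIST).  Part I of the
lane (`QuarticTwistModel` → `QuarticTwistSquares` → `QuarticTwistReduction` → `QuarticTwistResidual` → `QuarticTwistGenerate`).
Bookkeeping definitions + theorems, Mathlib-only mathematics; no `decide` table, no certificate, no named fact, no geometry, no `sorry`.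
HONEST FRAMING: `HC_CM` is NOT proved, here or anywhere in the tree; nothing here is a headline and nothing here produces a period.

WHY.  The least number `μ(G, c)` of Galois orbits of rank-four faces generating the Hodge lattice of the whole slice of a Galois CM
type `(G, c)` modulo divisor classes is a kernel theorem for `G` cyclic (b23, `Census/CyclicFacesGenerate`) and for `c` COMPLEMENTED,
`G = A × ⟨c⟩` (`Census/OddSliceFaces*`, `Census/EvenSliceFaces*`; b23's `ComplementFaces*` for non-abelian `A`).  The TWISTED
non-cyclic types — `c` a square — had no generation construction (b23 recon `HOME/pub-hodgecm2-b23/NONABELIAN-SLICE.md` §2).  This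
lane treats the first twisted family, the QUARTIC TWIST: `G = ⟨u⟩ × B` with `u` central of order `4` and `c = u²`, `B` ANY finite
group — the Galois CM fields `F = k₄·L` with `k₄` a cyclic quartic CM field and `L` totally real Galois with group `B`
(`conj = u²` for a generator `u` of `Gal(F/L) ≅ ℤ/4`).  Numerically (seat note `HOME/pub-hodgecm2-b09/lean-g32/QUARTIC-TWIST.md`) one
uniform construction attains `φ₂ = β − 1 − [B has an element of order 4]` on every such pair of order `≤ 32`; parts I–V prove the
case `|B|` odd: `μ(ℤ/4 × B) = β − 1`.

THE MODEL (dictionary as in `Census/OddSliceFacesModel.lean`, not formalised here).  Write `G = ℤ/4 × B` additively (`B` an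
`AddGroup`, commutativity is never used), `c = (2, 0)`.  A CM type `Ψ` (`x ∈ Ψ ↔ x + c ∉ Ψ`) meets the column `ℤ/4 × {b}` in a pair
`{(s, b), (s + 1, b)}` of consecutive residues, so CM types are the CLOCK TYPES `s : B → ℤ/4` (`Ty B`), all `4^{|B|}` of them; the
conjugate type is `s + 2`; the Pohlmann coefficient of `g = (a, t)` at `s` is `+1` iff `g ∈ Ψ_s` iff `a ∈ {s t, s t + 1}` (`coef`); the
Hodge lattice `H` is the common kernel of the `4|B|` forms (`hodge`); the divisor pairs are `e_s + e_{s+2}` (`pairVec`, `pairs`); `G`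
acts on labels by `(tw (v,t) s)(b) = s(b + t) + v` and on exponent vectors by `transl`.  The PLACES of `F` over its maximal real subfield
are the pairs `{(j, b), (j + 2, b)}`, `j ∈ ℤ/2`; the flip of `s` at the place `(j, b)` moves `s b` by `+1` if `s b ≡ j (mod 2)` and by
`−1` otherwise (`flip`, `flip_apply_self`), two flips in one column move by `2` (`flip_flip_same`).

CONTENT.  §1 labels, action (`tw_tw`, `twEquiv`), coefficients (`coef_tw`, `coef_add_two`), constant and atom types (`cst`, `atom`),
`transl`/`translHom`/`transl_single`; §2 the Hodge lattice, pairs (`pairVec_mem`), `G`-stability (`transl_mem`), testing membership on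
`a ∈ {0,1}` is not needed — all forms are kept; §3 parity `par : ℤ/4 → ℤ/2`, places, `flip` (`flip_eq_add_single`, `flip_flip_same`,
`flip_comm`, `tw_flip`).  All [folklore].

## References
* [Pohlmann1968] H. Pohlmann, Algebraic cycles on abelian varieties of complex multiplication type, Ann. of Math. 88 (1968), Thm 1.
* [Milne1999] J. S. Milne, Lefschetz motives and the Tate conjecture, Compositio Math. 117 (1999), Prop. 2.1, p. 54.
-/

namespace Summit.HodgeConjecture.CorCM.Census.QuarticTwist

open Finset

/-! ## §1 Labels, the action, coefficients, constant and atom types -/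

section Labels

variable (B : Type) [AddGroup B] [DecidableEq B]

/-- The labels of the whole slice of the quartic twist `(ℤ/4 × B, (2,0))`: CM types as clock maps `B → ℤ/4` (the type of `s` meets
the column over `b` in `{s b, s b + 1}`). [folklore] -/
abbrev Ty : Type := B → ZMod 4

/-- Pohlmann's coefficient of `g = (a, t) ∈ G` at the label `s`: `+1` if `g` lies in the type (`a ∈ {s t, s t + 1}`), `−1` otherwise.
[cite: Pohlmann1968, Thm 1] -/
def coef (g : ZMod 4 × B) (s : Ty B) : ℤ := if g.1 = s g.2 ∨ g.1 = s g.2 + 1 then 1 else -1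

/-- The action of `G = ℤ/4 × B` on labels: `(tw (v,t) s)(b) = s(b + t) + v`. [folklore] -/
def tw (g : ZMod 4 × B) (s : Ty B) : Ty B := fun b => s (b + g.2) + g.1

/-- Galois translate of an exponent vector: `(g·v)(s) = v(g⁻¹·s)`. [folklore] -/
def transl (g : ZMod 4 × B) (v : Ty B → ℤ) : Ty B → ℤ := fun s => v (tw B (-g) s)

/-- The constant type `u` (the four CM types of the cyclic quartic subfield `k₄ = F^B`). [folklore] -/
def cst (u : ZMod 4) : Ty B := fun _ => u

/-- The atom `u + k·δ_b`: value `u + k` at `b`, value `u` elsewhere. [folklore] -/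
def atom (u : ZMod 4) (b : B) (k : ZMod 4) : Ty B := cst B u + Pi.single b k

omit [AddGroup B] [DecidableEq B] in
/-- The coefficients at conjugate labels are opposite. [folklore] -/
theorem coef_add_two (g : ZMod 4 × B) (s : Ty B) : coef B g (s + 2) = -coef B g s := by
  have key : ∀ a x : ZMod 4, (if a = x + 2 ∨ a = x + 2 + 1 then (1 : ℤ) else -1) = -(if a = x ∨ a = x + 1 then (1 : ℤ) else -1) := by
    decide
  exact key g.1 (s g.2)

omit [DecidableEq B] in
/-- Composition of twists. [folklore] -/
theorem tw_tw (g h : ZMod 4 × B) (s : Ty B) : tw B g (tw B h s) = tw B (g + h) s := by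
  funext b
  simp only [tw, Prod.snd_add, Prod.fst_add]
  rw [add_assoc b, add_assoc, add_comm h.1 g.1]

omit [DecidableEq B] in
/-- Twisting by `0` is the identity. [folklore] -/
theorem tw_zero (s : Ty B) : tw B 0 s = s := by
  funext b; simp [tw]

omit [DecidableEq B] in
/-- `tw (−g) (tw g s) = s`. [folklore] -/
theorem tw_neg_tw (g : ZMod 4 × B) (s : Ty B) : tw B (-g) (tw B g s) = s := by
  rw [tw_tw, neg_add_cancel, tw_zero]

omit [DecidableEq B] in
/-- `tw g (tw (−g) s) = s`. [folklore] -/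
theorem tw_tw_neg (g : ZMod 4 × B) (s : Ty B) : tw B g (tw B (-g) s) = s := by
  rw [tw_tw, add_neg_cancel, tw_zero]

/-- Twisting by `g` as a permutation of the labels. [folklore] -/
def twEquiv (g : ZMod 4 × B) : Ty B ≃ Ty B where
  toFun := tw B g
  invFun := tw B (-g)
  left_inv := tw_neg_tw B g
  right_inv := tw_tw_neg B g

omit [DecidableEq B] in
/-- Twisting by `c = (2,0)` is conjugation. [folklore] -/
theorem tw_two_zero (s : Ty B) : tw B (2, 0) s = s + 2 := by
  funext b; simp [tw]

omit [DecidableEq B] in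
/-- Twisting commutes with conjugation. [folklore] -/
theorem tw_add_two (g : ZMod 4 × B) (s : Ty B) : tw B g (s + 2) = tw B g s + 2 := by
  funext b
  simp only [tw, Pi.add_apply, Pi.ofNat_apply]
  ring

omit [DecidableEq B] in
/-- The coefficient of `h = (a, t)` at a twisted label is the coefficient of `(a − v, t + t')` where `g = (v, t')`. [folklore] -/
theorem coef_tw (g h : ZMod 4 × B) (s : Ty B) : coef B h (tw B g s) = coef B (h.1 - g.1, h.2 + g.2) s := by
  have key : ∀ a v x : ZMod 4, (a = x + v ∨ a = x + v + 1) ↔ (a - v = x ∨ a - v = x + 1) := by decide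
  unfold coef tw
  by_cases hc : h.1 - g.1 = s (h.2 + g.2) ∨ h.1 - g.1 = s (h.2 + g.2) + 1
  · rw [if_pos hc, if_pos ((key _ _ _).mpr hc)]
  · rw [if_neg hc, if_neg (fun h' => hc ((key _ _ _).mp h'))]

omit [DecidableEq B] in
/-- Twist of a constant type. [folklore] -/
theorem tw_cst (g : ZMod 4 × B) (u : ZMod 4) : tw B g (cst B u) = cst B (u + g.1) := by
  funext b; simp [tw, cst]

/-- Twist of a type plus a single value: `tw g (s + δ_b·k) = tw g s + δ_{b − t}·k`. [folklore] -/
theorem tw_add_single (g : ZMod 4 × B) (s : Ty B) (b : B) (k : ZMod 4) :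
    tw B g (s + Pi.single b k) = tw B g s + Pi.single (b - g.2) k := by
  funext x
  simp only [tw, Pi.add_apply, Pi.single_apply]
  have hiff : x + g.2 = b ↔ x = b - g.2 := by
    constructor
    · intro h; rw [← h, add_sub_cancel_right]
    · intro h; rw [h, sub_add_cancel]
  by_cases hx : x = b - g.2
  · rw [if_pos hx, if_pos (hiff.mpr hx)]; ring
  · rw [if_neg hx, if_neg (fun h => hx (hiff.mp h))]; ring

/-- Twist of an atom: `tw (v,t) (u + k·δ_b) = (u + v) + k·δ_{b − t}`. [folklore] -/
theorem tw_atom (g : ZMod 4 × B) (u : ZMod 4) (b : B) (k : ZMod 4) :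
    tw B g (atom B u b k) = atom B (u + g.1) (b - g.2) k := by
  unfold atom
  rw [tw_add_single, tw_cst]

omit [AddGroup B] in
/-- Values of an atom. [folklore] -/
theorem atom_apply (u : ZMod 4) (b : B) (k : ZMod 4) (x : B) : atom B u b k x = if x = b then u + k else u := by
  unfold atom cst
  simp only [Pi.add_apply, Pi.single_apply]
  by_cases h : x = b
  · rw [if_pos h, if_pos h]
  · rw [if_neg h, if_neg h, add_zero]

omit [AddGroup B] in
/-- The atom with `k = 0` is the constant type. [folklore] -/
theorem atom_zero (u : ZMod 4) (b : B) : atom B u b 0 = cst B u := by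
  unfold atom; simp

omit [AddGroup B] in
/-- An atom plus `2` is the atom over `u + 2`. [folklore] -/
theorem atom_add_two (u : ZMod 4) (b : B) (k : ZMod 4) : atom B u b k + 2 = atom B (u + 2) b k := by
  funext x
  simp only [Pi.add_apply, atom_apply, Pi.ofNat_apply]
  by_cases h : x = b
  · rw [if_pos h, if_pos h]; ring
  · rw [if_neg h, if_neg h]

omit [AddGroup B] [DecidableEq B] in
/-- A constant type plus `2`. [folklore] -/
theorem cst_add_two (u : ZMod 4) : cst B u + 2 = cst B (u + 2) := by
  funext x; simp [cst]

omit [DecidableEq B] in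
/-- `transl` as composition with the inverse permutation. [folklore] -/
theorem transl_eq_comp (g : ZMod 4 × B) (v : Ty B → ℤ) : transl B g v = v ∘ (twEquiv B g).symm := rfl

/-- Translation by `g` as a `ℤ`-linear map. [folklore] -/
def translHom (g : ZMod 4 × B) : (Ty B → ℤ) →ₗ[ℤ] (Ty B → ℤ) where
  toFun := transl B g
  map_add' _ _ := rfl
  map_smul' _ _ := rfl

omit [DecidableEq B] in
/-- `translHom` is `transl`. [folklore] -/
@[simp] theorem translHom_apply (g : ZMod 4 × B) (v : Ty B → ℤ) : translHom B g v = transl B g v := rfl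

omit [DecidableEq B] in
/-- Translation by `0` is the identity. [folklore] -/
theorem transl_zero (v : Ty B → ℤ) : transl B 0 v = v := by
  funext s
  simp only [transl, neg_zero, tw_zero]

omit [DecidableEq B] in
/-- Translation is additive in the vector. [folklore] -/
theorem transl_add (g : ZMod 4 × B) (v w : Ty B → ℤ) : transl B g (v + w) = transl B g v + transl B g w := rfl

omit [DecidableEq B] in
/-- Translation commutes with subtraction. [folklore] -/
theorem transl_sub (g : ZMod 4 × B) (v w : Ty B → ℤ) : transl B g (v - w) = transl B g v - transl B g w := rfl

omit [DecidableEq B] in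
/-- Translation commutes with integer scaling. [folklore] -/
theorem transl_smul (g : ZMod 4 × B) (c : ℤ) (v : Ty B → ℤ) : transl B g (c • v) = c • transl B g v := rfl

end Labels

/-! ## §2 Forms, the Hodge lattice, pairs, translation -/

section Lattice

variable (B : Type) [AddGroup B] [Fintype B] [DecidableEq B]

/-- **The Hodge lattice** of the whole slice of the quartic twist in the clock labelling: exponent vectors killed by all Pohlmann forms.
[cite: Pohlmann1968, Thm 1] -/
def hodge : Submodule ℤ (Ty B → ℤ) where
  carrier := {m | ∀ g : ZMod 4 × B, coef B g ⬝ᵥ m = 0}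
  zero_mem' := by intro g; simp
  add_mem' := by
    intro m m' hm hm' g
    rw [dotProduct_add, hm g, hm' g, add_zero]
  smul_mem' := by
    intro c m hm g
    rw [dotProduct_smul, hm g, smul_zero]

/-- The conjugate (divisor) pair through the label `s`: `e_s + e_{s+2}`. [folklore] -/
def pairVec (s : Ty B) : Ty B → ℤ := Pi.single s 1 + Pi.single (s + 2) 1

/-- The divisor sublattice `P = ℤ⟨pairs⟩`. [folklore] -/
def pairs : Submodule ℤ (Ty B → ℤ) := Submodule.span ℤ (Set.range (pairVec B))

omit [AddGroup B] in
/-- **The pairs are Hodge vectors.** [folklore] -/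
theorem pairVec_mem (s : Ty B) : pairVec B s ∈ hodge B := by
  intro g
  show coef B g ⬝ᵥ (Pi.single s 1 + Pi.single (s + 2) 1) = 0
  rw [dotProduct_add, dotProduct_single, dotProduct_single, coef_add_two]
  ring

omit [AddGroup B] in
/-- `P ≤ H`. [folklore] -/
theorem pairs_le_hodge : pairs B ≤ hodge B := by
  refine Submodule.span_le.mpr ?_
  rintro _ ⟨s, rfl⟩
  exact pairVec_mem B s

omit [AddGroup B] [DecidableEq B] in
/-- A pair lies in `P`. [folklore] -/
theorem pairVec_mem_pairs (s : Ty B) : pairVec B s ∈ pairs B := Submodule.subset_span ⟨s, rfl⟩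

/-- The form of `h` on a translate is a form on the vector. [folklore] -/
theorem coef_dotProduct_transl (g h : ZMod 4 × B) (v : Ty B → ℤ) :
    coef B h ⬝ᵥ transl B g v = coef B (h.1 - g.1, h.2 + g.2) ⬝ᵥ v := by
  rw [transl_eq_comp, dotProduct_comp_equiv_symm]
  congr 1
  funext s
  exact coef_tw B g h s

/-- **`H` is stable under Galois translation.** [folklore] -/
theorem transl_mem {v : Ty B → ℤ} (hv : v ∈ hodge B) (g : ZMod 4 × B) : transl B g v ∈ hodge B := by
  intro h
  rw [coef_dotProduct_transl]
  exact hv _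

omit [DecidableEq B] in
/-- Translate of a unit vector. [folklore] -/
theorem transl_single (g : ZMod 4 × B) (s : Ty B) (c : ℤ) :
    transl B g (Pi.single s c) = Pi.single (tw B g s) c := by
  funext s'
  have hiff : tw B (-g) s' = s ↔ s' = tw B g s := by
    constructor
    · intro h; rw [← h, tw_tw_neg]
    · intro h; rw [h, tw_neg_tw]
  simp only [transl, Pi.single_apply, hiff]

omit [DecidableEq B] in
/-- Translate of a pair is the pair through the translated label. [folklore] -/
theorem transl_pairVec (g : ZMod 4 × B) (s : Ty B) : transl B g (pairVec B s) = pairVec B (tw B g s) := by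
  unfold pairVec
  rw [transl_add, transl_single, transl_single, tw_add_two]

omit [DecidableEq B] in
/-- **`P` is stable under Galois translation.** [folklore] -/
theorem transl_mem_pairs {v : Ty B → ℤ} (hv : v ∈ pairs B) (g : ZMod 4 × B) : transl B g v ∈ pairs B := by
  unfold pairs at hv ⊢
  induction hv using Submodule.span_induction with
  | mem x hx =>
    obtain ⟨s, rfl⟩ := hx
    rw [transl_pairVec]
    exact Submodule.subset_span ⟨_, rfl⟩
  | zero => rw [show transl B g 0 = 0 from rfl]; exact Submodule.zero_mem _
  | add x y _ _ hx hy => rw [transl_add]; exact Submodule.add_mem _ hx hy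
  | smul a x _ hx => rw [transl_smul]; exact Submodule.smul_mem _ a hx

omit [AddGroup B] in
/-- The form of `(a, t)` on a unit vector. [folklore] -/
theorem coef_dotProduct_single (g : ZMod 4 × B) (s : Ty B) (c : ℤ) :
    coef B g ⬝ᵥ Pi.single s c = (if g.1 = s g.2 ∨ g.1 = s g.2 + 1 then 1 else -1) * c := by
  rw [dotProduct_single]
  simp only [coef]

omit [AddGroup B] [DecidableEq B] in
/-- A unit vector at a conjugate label is a pair minus the unit vector: `e_{s+2} = pairVec s − e_s`. [folklore] -/
theorem single_add_two (s : Ty B) : (Pi.single (s + 2) (1 : ℤ) : Ty B → ℤ) = pairVec B s - Pi.single s 1 := by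
  unfold pairVec; abel

end Lattice

/-! ## §3 Parity, places and flips -/

section Flips

variable (B : Type) [AddGroup B] [DecidableEq B]

/-- The parity map `ℤ/4 → ℤ/2`. [folklore] -/
def par : ZMod 4 →+* ZMod 2 := ZMod.castHom (show 2 ∣ 4 by norm_num) (ZMod 2)

/-- The step of the flip at the place `(j, b)` on a type with value `x` at `b`: `+1` if `x ≡ j (mod 2)`, else `−1`. [folklore] -/
def step (j : ZMod 2) (x : ZMod 4) : ZMod 4 := if par x = j then 1 else -1

/-- A step is `±1`. [folklore] -/
theorem step_eq_or (j : ZMod 2) (x : ZMod 4) : step j x = 1 ∨ step j x = -1 := by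
  unfold step; split_ifs
  · exact Or.inl rfl
  · exact Or.inr rfl

/-- **The flip** of the type `s` at the place `(j, b)` (the pair `{(j, b), (j+2, b)}` of `G`): the value at `b` moves by `step j (s b)`.
[folklore] -/
def flip (p : ZMod 2 × B) (s : Ty B) : Ty B := s + Pi.single p.2 (step p.1 (s p.2))

omit [AddGroup B] in
/-- The flip as `s +` a single value. [folklore] -/
theorem flip_eq_add_single (p : ZMod 2 × B) (s : Ty B) : flip B p s = s + Pi.single p.2 (step p.1 (s p.2)) := rfl

omit [AddGroup B] in
/-- Value of the flipped type at its own column. [folklore] -/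
theorem flip_apply_self (p : ZMod 2 × B) (s : Ty B) : flip B p s p.2 = s p.2 + step p.1 (s p.2) := by
  simp [flip]

omit [AddGroup B] in
/-- Value of the flipped type at another column. [folklore] -/
theorem flip_apply_of_ne (p : ZMod 2 × B) (s : Ty B) {x : B} (hx : x ≠ p.2) : flip B p s x = s x := by
  simp [flip, hx]

/-- After a step the parity changes, so the OTHER place `j + 1` of the column repeats the step: `step (j+1) (x + step j x) = step j x`.
[folklore] -/
theorem step_add_step (j : ZMod 2) (x : ZMod 4) : step (j + 1) (x + step j x) = step j x := by
  have key : ∀ (j : ZMod 2) (x : ZMod 4),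
      (if par (x + (if par x = j then 1 else -1)) = j + 1 then (1 : ZMod 4) else -1) = (if par x = j then 1 else -1) := by
    decide
  exact key j x

omit [AddGroup B] in
/-- **Two flips in one column move the value by `2`**: flipping at `(j, b)` and then at `(j + 1, b)` gives `s + 2·δ_b`. [folklore] -/
theorem flip_flip_same (j : ZMod 2) (b : B) (s : Ty B) :
    flip B (j + 1, b) (flip B (j, b) s) = s + Pi.single b 2 := by
  funext x
  by_cases hx : x = b
  · subst hx
    rw [flip_apply_self, flip_apply_self, step_add_step, Pi.add_apply, Pi.single_eq_same, add_assoc]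
    congr 1
    rcases step_eq_or j (s x) with h | h <;> rw [h] <;> decide
  · rw [flip_apply_of_ne B _ _ (by exact hx), flip_apply_of_ne B _ _ (by exact hx), Pi.add_apply, Pi.single_eq_of_ne hx, add_zero]

omit [AddGroup B] in
/-- **Flips at places in different columns commute**, and the double flip adds both single values. [folklore] -/
theorem flip_flip_of_ne (p q : ZMod 2 × B) (hpq : p.2 ≠ q.2) (s : Ty B) :
    flip B q (flip B p s) = s + Pi.single p.2 (step p.1 (s p.2)) + Pi.single q.2 (step q.1 (s q.2)) := by
  rw [flip_eq_add_single B q, flip_apply_of_ne B p s (Ne.symm hpq), flip_eq_add_single]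

omit [AddGroup B] in
/-- Flips in different columns commute. [folklore] -/
theorem flip_comm (p q : ZMod 2 × B) (hpq : p.2 ≠ q.2) (s : Ty B) : flip B q (flip B p s) = flip B p (flip B q s) := by
  rw [flip_flip_of_ne B p q hpq, flip_flip_of_ne B q p (Ne.symm hpq)]
  abel

/-- **Twists transport flips**: `tw (v,t) (flip (j,b) s) = flip (j + par v, b − t) (tw (v,t) s)`. [folklore] -/
theorem tw_flip (g : ZMod 4 × B) (p : ZMod 2 × B) (s : Ty B) :
    tw B g (flip B p s) = flip B (p.1 + par g.1, p.2 - g.2) (tw B g s) := by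
  rw [flip_eq_add_single, flip_eq_add_single, tw_add_single]
  congr 2
  have htw : tw B g s (p.2 - g.2) = s p.2 + g.1 := by simp [tw]
  rw [htw]
  have key : ∀ (j : ZMod 2) (x v : ZMod 4),
      (if par x = j then (1 : ZMod 4) else -1) = (if par (x + v) = j + par v then 1 else -1) := by decide
  exact key p.1 (s p.2) g.1

end Flips

end Summit.HodgeConjecture.CorCM.Census.QuarticTwist
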